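import Mathlib
import Summits.Ventures.PercRepro.TriangleCapSubBandExact

/-!
# PercRepro — THE STRUCTURE THEOREM WITHOUT THE SMALL-DEGREE REGIME, AND THE COMPLETE BAND ON `3 + (s − t)` VERTICES
(p3, gen 52; part 266)

Every off-edge has an end among the non-neighbours (it is not inside `N(w)`), so `t ≤ Σ_{nonNbrs} offDeg`
(`sum_offDeg_nonNbrs_ge`): when `ℓ (u₀ + 1) < t` some non-neighbour carries `≥ u₀ + 2` off-edges and the
small-degree regime of part 260 is empty — THE STRUCTURE THEOREM holds with `ℓ (u₀ + 1) < t` in place of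
`4 u₀ + 3 ≤ t` (`subband_structure'`, `band_exact'`).  For `ℓ = 2` this reaches the depth `u₀ = ⌊t/2⌋ − 2`, and with
the extremal bound of part 247 at the top: **THE BAND `t` ON `3 + (s − t)` VERTICES IS EXACTLY
`{0, 1} ∪ ⋃_{1 ≤ u ≤ t/2} [u (t − u − 1), u (t − u)]`** (`band_two_complete`, `4 ≤ t`, `2 t ≤ s`) — the first
complete description of a band on `n` vertices with gaps.  Axioms: standard.
-/

namespace PercRepro

namespace TriangleCap

namespace C047

open Finset

variable {V : Type*} [Fintype V] [DecidableEq V]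

/-- Every off-edge has an end among the non-neighbours of `w`. -/
theorem one_le_card_ends_nonNbrs (H : SimpleGraph V) [DecidableRel H.Adj] (hfree : H.CliqueFree 3) (w : V)
    (e : Sym2 V) (he : e ∈ offEdges H w) : 1 ≤ ((nonNbrs H w).filter (fun v => v ∈ e)).card := by
  revert he
  induction e using Sym2.ind with
  | _ p q =>
  intro he
  have hpw : p ≠ w := fun h => notMem_of_mem_offEdges H w he (h ▸ Sym2.mem_mk_left p q)
  have hqw : q ≠ w := fun h => notMem_of_mem_offEdges H w he (h ▸ Sym2.mem_mk_right p q)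
  have hpq : H.Adj p q := (mem_offEdges_iff_adj H w p q hpw hqw).mp he
  rw [Nat.succ_le_iff, card_pos]
  by_cases hwp : H.Adj w p
  · have hwq : ¬ H.Adj w q := not_adj_of_adj_adj H hfree hwp.symm hpq
    exact ⟨q, mem_filter.mpr ⟨(mem_nonNbrs H w q).mpr ⟨hqw, hwq⟩, Sym2.mem_mk_right p q⟩⟩
  · exact ⟨p, mem_filter.mpr ⟨(mem_nonNbrs H w p).mpr ⟨hpw, hwp⟩, Sym2.mem_mk_left p q⟩⟩

/-- **THE NON-NEIGHBOURS CARRY EVERY OFF-EDGE:** `|F| ≤ Σ_{nonNbrs} offDeg`. -/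
theorem sum_offDeg_nonNbrs_ge (H : SimpleGraph V) [DecidableRel H.Adj] (hfree : H.CliqueFree 3) (w : V) :
    (offEdges H w).card ≤ ∑ v ∈ nonNbrs H w, offDeg H w v := by
  unfold offDeg
  simp_rw [card_filter]
  rw [sum_comm, card_eq_sum_ones]
  apply sum_le_sum
  intro e he
  have := one_le_card_ends_nonNbrs H hfree w e he
  rw [card_filter] at this
  exact this

/-- **THE SUB-BAND STRUCTURE THEOREM WITHOUT THE SMALL-DEGREE REGIME:** with `|nonNbrs| (u₀ + 1) < t` and
`|nonNbrs| + u₀ + 1 ≤ t`, the band value `2 j` lies in a sub-band `u ≤ u₀` or satisfies `(u₀ + 1)(t − u₀ − 2) ≤ j`. -/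
theorem subband_structure' (H : SimpleGraph V) [DecidableRel H.Adj] (hfree : H.CliqueFree 3) (s t j u₀ : ℕ)
    (hs : H.edgeFinset.card = s) (w : V) (hw : 1 ≤ deg H w) (ht : (offEdges H w).card = t)
    (hj : ∑ v, deg H v * deg H v + 2 * (t * (s - t - 1)) + 2 * j = s * (s + 1))
    (ht0 : (nonNbrs H w).card * (u₀ + 1) < t) (hℓ : (nonNbrs H w).card + u₀ + 1 ≤ t) :
    (∃ u, u ≤ u₀ ∧ u * (t - u - 1) ≤ j ∧ ∀ q, 1 ≤ q →
      2 * j + 2 * (q * u) ≤ 2 * (u * (t - u - 1)) + u * (u + 1) + ((nonNbrs H w).card - 1) * (q * (q + 1))) ∨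
    (u₀ + 1) * (t - u₀ - 2) ≤ j := by
  obtain ⟨x, -, hxmax⟩ := exists_max_image (univ : Finset V) (offDeg H w) ⟨w, mem_univ w⟩
  have hle := offDeg_le_card H w x
  rw [ht] at hle
  by_cases hcase : t ≤ offDeg H w x + u₀
  · left
    have hxN : ¬ H.Adj w x := by
      intro hxN
      have := offDeg_le_card_nonNbrs_of_adj' H hfree w x hxN
      omega
    refine ⟨t - offDeg H w x, by omega, subband_lower_bound H hfree s t _ j hs w hw ht hj x (by omega),
      fun q hq => subband_upper_bound H hfree s t _ j hs w hw ht hj x (by omega) hxN (by omega) q hq⟩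
  · right
    by_cases hbig : u₀ + 2 ≤ offDeg H w x
    · have hb := subband_lower_bound H hfree s t (t - offDeg H w x) j hs w hw ht hj x (by omega)
      have := subband_bottom_concave t (t - offDeg H w x) u₀ (by omega) (by omega)
      omega
    · -- every off-degree `≤ u₀ + 1` contradicts `t ≤ Σ_{nonNbrs} offDeg ≤ |nonNbrs| (u₀ + 1)`
      exfalso
      have hsum := sum_offDeg_nonNbrs_ge H hfree w
      rw [ht] at hsum
      have hbound : ∑ v ∈ nonNbrs H w, offDeg H w v ≤ ∑ _v ∈ nonNbrs H w, (u₀ + 1) := by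
        apply sum_le_sum
        intro v _
        have := hxmax v (mem_univ v)
        omega
      rw [sum_const, smul_eq_mul] at hbound
      omega

/-- The `n`-vertex form of `subband_structure'`. -/
theorem subband_structure_vertices' (ℓ s t : ℕ) (H : SimpleGraph (Fin (ℓ + 1 + (s - t)))) [DecidableRel H.Adj]
    (hfree : H.CliqueFree 3) (hs : H.edgeFinset.card = s) (w : Fin (ℓ + 1 + (s - t))) (hw : deg H w + t = s)
    (hw1 : 1 ≤ deg H w) (u₀ j : ℕ) (ht0 : ℓ * (u₀ + 1) < t) (hℓ : ℓ + u₀ + 1 ≤ t)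
    (hj : ∑ v, deg H v * deg H v + 2 * (t * (s - t - 1)) + 2 * j = s * (s + 1)) :
    (∃ u, u ≤ u₀ ∧ u * (t - u - 1) ≤ j ∧ ∀ q, 1 ≤ q →
      2 * j + 2 * (q * u) ≤ 2 * (u * (t - u - 1)) + u * (u + 1) + (ℓ - 1) * (q * (q + 1))) ∨
    (u₀ + 1) * (t - u₀ - 2) ≤ j := by
  have hc := card_nonNbrs_add H w
  rw [Fintype.card_fin] at hc
  have hcard := card_offEdges_add_deg H w
  have hℓ' : (nonNbrs H w).card = ℓ := by omega
  have := subband_structure' H hfree s t j u₀ hs w hw1 (by omega) hj (by rw [hℓ']; exact ht0) (by omega)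
  rw [hℓ'] at this
  exact this

/-- **THE BAND BELOW `(u₀ + 1)(t − u₀ − 2)`, EXACTLY, WITHOUT THE SMALL-DEGREE HYPOTHESIS:** for `2 ≤ ℓ`,
`ℓ (u₀ + 1) < t`, `ℓ + u₀ + 1 ≤ t`, `2 t ≤ s` and `j < (u₀ + 1)(t − u₀ − 2)`, the band value `2 j` is attained on
`ℓ + 1 + (s − t)` vertices iff `j` lies in a sub-band interval `u ≤ u₀`. -/
theorem band_exact' (ℓ s t u₀ j : ℕ) (hℓ : 2 ≤ ℓ) (ht0 : ℓ * (u₀ + 1) < t) (hℓt : ℓ + u₀ + 1 ≤ t) (hs : 2 * t ≤ s)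
    (hj : j < (u₀ + 1) * (t - u₀ - 2)) :
    (∃ (H : SimpleGraph (Fin (ℓ + 1 + (s - t)))) (_ : DecidableRel H.Adj), H.CliqueFree 3 ∧
      H.edgeFinset.card = s ∧ (∃ w, deg H w + t = s) ∧
      ∑ v, deg H v * deg H v + 2 * (t * (s - t - 1)) + 2 * j = s * (s + 1)) ↔
    ∃ u, u ≤ u₀ ∧ u * (t - u - 1) ≤ j ∧
      2 * j + 2 * (subQ ℓ u * u) ≤ 2 * (u * (t - u - 1)) + u * (u + 1) + (ℓ - 1) * (subQ ℓ u * (subQ ℓ u + 1)) := by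
  have h2u : 2 * u₀ + 2 < t := by nlinarith
  constructor
  · rintro ⟨H, _, hfree, hs', ⟨w, hw⟩, hj'⟩
    rcases subband_structure_vertices' ℓ s t H hfree hs' w hw (by omega) u₀ j ht0 hℓt hj' with
      ⟨u, hu, hlow, hup⟩ | hbig
    · exact ⟨u, hu, hlow, hup (subQ ℓ u) (le_max_left _ _)⟩
    · omega
  · rintro ⟨u, hu, hlow, hup⟩
    rcases Nat.eq_zero_or_pos u with rfl | hu1
    · unfold subQ at hup
      rw [Nat.zero_div, max_eq_left (Nat.zero_le 1)] at hup
      simp only [mul_zero, zero_mul, add_zero, zero_add] at hup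
      exact starWitness ℓ s t j (by omega) hs (by omega) (by omega)
    · rcases Nat.lt_or_ge u (ℓ - 1) with hsmall | hbig
      · have hq : subQ ℓ u = 1 := by
          unfold subQ
          rw [Nat.div_eq_of_lt hsmall, max_eq_left (Nat.zero_le 1)]
        rw [hq] at hup
        apply subband_interval_small ℓ s t u j hu1 (by omega) (by omega) (by omega) hs hlow
        omega
      · have hq : subQ ℓ u = u / (ℓ - 1) := by
          unfold subQ
          exact max_eq_right (Nat.div_pos hbig (by omega))
        rw [hq] at hup
        exact (subband_interval_exact ℓ s t u hℓ (by omega) (by omega) hs).2 j hlow hup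

/-- **THE COMPLETE BAND ON `3 + (s − t)` VERTICES:** for `4 ≤ t`, `2 t ≤ s`, the band value `2 j` is attained on
`3 + (s − t)` vertices (two non-neighbours) iff `j ≤ 1` or `u (t − u − 1) ≤ j ≤ u (t − u)` for some `1 ≤ u ≤ t / 2`. -/
theorem band_two_complete (s t j : ℕ) (ht : 4 ≤ t) (hs : 2 * t ≤ s) :
    (∃ (H : SimpleGraph (Fin (2 + 1 + (s - t)))) (_ : DecidableRel H.Adj), H.CliqueFree 3 ∧
      H.edgeFinset.card = s ∧ (∃ w, deg H w + t = s) ∧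
      ∑ v, deg H v * deg H v + 2 * (t * (s - t - 1)) + 2 * j = s * (s + 1)) ↔
    (j ≤ 1 ∨ ∃ u, 1 ≤ u ∧ 2 * u ≤ t ∧ u * (t - u - 1) ≤ j ∧ j ≤ u * (t - u)) := by
  -- the sub-band bound at `ℓ = 2`, `q = u`: `j ≤ u (t − u)`
  have hsub : ∀ u, 1 ≤ u → u + 1 ≤ t → (2 * j + 2 * ((u / (2 - 1)) * u) ≤ 2 * (u * (t - u - 1)) + u * (u + 1) +
      (2 - 1) * ((u / (2 - 1)) * (u / (2 - 1) + 1)) ↔ j ≤ u * (t - u)) := by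
    intro u hu hut
    have e1 : (2 : ℕ) - 1 = 1 := rfl
    rw [e1, Nat.div_one, one_mul]
    have e2 : u * (t - u) = u * (t - u - 1) + u := by
      obtain ⟨d, rfl⟩ : ∃ d, t = u + 1 + d := ⟨t - u - 1, by omega⟩
      have e3 : u + 1 + d - u = d + 1 := by omega
      have e4 : u + 1 + d - u - 1 = d := by omega
      rw [e4, e3]
      ring
    rw [e2]
    constructor <;> intro h <;> nlinarith
  constructor
  · rintro ⟨H, _, hfree, hs', ⟨w, hw⟩, hj'⟩
    obtain ⟨q, hq⟩ : ∃ q, q = t / 2 := ⟨_, rfl⟩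
    have hq2 : 2 ≤ q := by omega
    have hqt : 2 * q ≤ t := by omega
    have hqt' : t ≤ 2 * q + 1 := by omega
    -- the top of the band (part 247): `j ≤ q (t − q)`
    have htop : j ≤ q * (t - q) := by
      have hext := (vertex_band_extremal 2 s t (by omega) (by omega) hs).1 H hfree hs' w hw j hj'
      have hb := hext.2.2 (by omega)
      rw [← hq] at hb
      obtain ⟨q', rfl⟩ : ∃ q', q = q' + 2 := ⟨q - 2, by omega⟩
      rcases Nat.lt_or_ge t (2 * (q' + 2) + 1) with h | h
      · have ht2 : t = 2 * (q' + 2) := by omega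
        subst ht2
        have e : 2 * (q' + 2) - (q' + 2) = q' + 2 := by omega
        have e' : 2 * (q' + 2) - 1 = 2 * q' + 3 := by omega
        rw [e]
        rw [e'] at hb
        nlinarith
      · have ht2 : t = 2 * (q' + 2) + 1 := by omega
        subst ht2
        have e : 2 * (q' + 2) + 1 - (q' + 2) = q' + 3 := by omega
        have e' : 2 * (q' + 2) + 1 - 1 = 2 * q' + 4 := by omega
        rw [e]
        rw [e'] at hb
        nlinarith
    rcases subband_structure_vertices' 2 s t H hfree hs' w hw (by omega) (q - 2) j (by omega) (by omega) hj' with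
      ⟨u, hu, hlow, hup⟩ | hbig
    · rcases Nat.eq_zero_or_pos u with rfl | hu1
      · left
        have := hup 1 le_rfl
        simp only [mul_zero, zero_mul, add_zero, zero_add] at this
        omega
      · right
        refine ⟨u, hu1, by omega, hlow, ?_⟩
        exact (hsub u hu1 (by omega)).mp
          (hup (u / (2 - 1)) (by rw [show (2 : ℕ) - 1 = 1 from rfl, Nat.div_one]; exact hu1))
    · right
      -- `(q − 1)(t − q) ≤ j ≤ q (t − q)`: the sub-band `q − 1` or `q`
      have e1 : q - 2 + 1 = q - 1 := by omega
      have e2 : t - (q - 2) - 2 = t - q := by omega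
      rw [e1, e2] at hbig
      by_cases hc : j ≤ (q - 1) * (t - (q - 1))
      · refine ⟨q - 1, by omega, by omega, ?_, hc⟩
        have : t - (q - 1) - 1 = t - q := by omega
        rw [this]
        exact hbig
      · refine ⟨q, by omega, hqt, ?_, htop⟩
        -- `q (t − q − 1) ≤ (q − 1)(t − q + 1) + 1 < j`
        have h1 : q * (t - q - 1) + q = q * (t - q) := by
          have : t - q = t - q - 1 + 1 := by omega
          rw [this]
          have : t - q - 1 + 1 - 1 = t - q - 1 := by omega
          rw [this]
          ring
        have h2 : (q - 1) * (t - (q - 1)) = (q - 1) * (t - q) + (q - 1) := by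
          have : t - (q - 1) = t - q + 1 := by omega
          rw [this]
          ring
        have h3 : (q - 1) * (t - q) + (t - q) = q * (t - q) := by
          obtain ⟨q', rfl⟩ : ∃ q', q = q' + 1 := ⟨q - 1, by omega⟩
          rw [Nat.add_sub_cancel]
          ring
        omega
  · rintro (h | ⟨u, hu1, hut, hlow, hup⟩)
    · exact starWitness 2 s t j (by omega) hs (by omega) (by omega)
    · exact (subband_interval_exact 2 s t u le_rfl (by omega) hut hs).2 j hlow ((hsub u hu1 (by omega)).mpr hup)

/-- **THE COMPLETE BAND ON `2 + (s − t)` VERTICES:** with one non-neighbour (`1 ≤ t`, `2 t ≤ s`) the only band value is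
`j = 0` (all off-edges form a star at the non-neighbour with its ends at leaves). -/
theorem band_one_complete (s t j : ℕ) (ht : 1 ≤ t) (hs : 2 * t ≤ s) :
    (∃ (H : SimpleGraph (Fin (1 + 1 + (s - t)))) (_ : DecidableRel H.Adj), H.CliqueFree 3 ∧
      H.edgeFinset.card = s ∧ (∃ w, deg H w + t = s) ∧
      ∑ v, deg H v * deg H v + 2 * (t * (s - t - 1)) + 2 * j = s * (s + 1)) ↔ j = 0 := by
  constructor
  · rintro ⟨H, _, hfree, hs', ⟨w, hw⟩, hj'⟩
    have hext := (vertex_band_extremal 1 s t le_rfl ht hs).1 H hfree hs' w hw j hj'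
    have hb := hext.2.2 ht
    rw [Nat.div_one] at hb
    have e : t * (t - 1) + t = t * t := by
      obtain ⟨t', rfl⟩ : ∃ t', t = t' + 1 := ⟨t - 1, by omega⟩
      rw [Nat.add_sub_cancel]
      ring
    nlinarith
  · rintro rfl
    exact starWitness 1 s t 0 ht hs le_rfl (Nat.zero_le _)

end C047

end TriangleCap

end PercRepro
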